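import Literature.AnabelianGeometry.EtaleTheta.RealificationPfImageWeak
import Literature.AlgebraicGeometry.Frobenioids.RealificationDataCanonicalWeak
import HarnessLib

/-!
# [FrdI] Prop. 5.3 / [EtTh] Def. 3.6 (i): the WEAK realification is functorial along a monoid ISOMORPHISM — `M ≅ N` induces
# `M^rlf ≅ N^rlf` over `M^pf ≅ N^pf`, carrying the image of `M^pf` onto the image of `N^pf` (class (b))

S. Mochizuki, *The geometry of Frobenioids I*, Kyushu J. Math. **62** (2008), Def. 2.4 (i) p.47, Prop. 5.3 p.103 («the divisor monoid
`Φ^rlf`» is functorial) [cite: MochizukiFrdI2008, Prop. 5.3 p.103]; S. Mochizuki, *The étale theta function …* (2009), Def. 3.6 (i) p.76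
(`Φ₀^ℝ := Φ₀^rlf`).

abc-iut cell, layer L2 [EtTh], seat abc-iut-w5-d179 (gen 6); VNEXT memo `VNEXT-Thm44Hyp-NonIdentityPsi-w5d179.md` piece 2 of 3
(piece 1 = p473513 `LogDivisorModelTateTowerReflection`: the Def. 3.3 (iii)-level isomorphism `dm X φ ≅ dm X φ⁻¹`).  To push an
isomorphism of Def. 3.3 (iii) data through Def. 3.6 (i) one needs the realification of a monoid ISOMORPHISM between two monoids EACH
weakly perf-factorial with cofinal perfection (two different `hpf` witnesses).  abc-iut-L2-d2's weak universal property
(`RlfUniversalWeak.existsUnique_map` / `map_id` / `map_comp`, `RealificationUniversalWeak.lean`) gives exactly this: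
* `RlfIsoWeak.map hM hN f : M^rlf →* N^rlf` over `f^pf` for ANY hom `f : M →* N` between two such monoids
  (`map_comp_toRealification`, `map_toRealification`); `map_comp_map` / `map_id'` (functoriality);
* **`RlfIsoWeak.equiv hM hN e : M^rlf ≃* N^rlf`** for `e : M ≃* N`, with `equiv_toRealification` (it lies over `e^pf`),
  `equiv_symm_apply_toRealification`, and **`map_mrange_toRealification_eq`**: it carries `im(M^pf → M^rlf)` ONTO `im(N^pf → N^rlf)`
  (print's `Φ := Φ₀^pf|_D`-images correspond); `ℝ`-linearity of `equiv^gp` is abc-iut-L1-d2's `IsPerfFactorialWeak.Rlf.map_realSMul`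
  (any hom), recorded as `equiv_realSMul`.
Class (b): 2 defs (`map`, `equiv`); no Prop fact, no instance, no notation, no sorry.  HONEST FRAMING: plumbing inside [FrdI] Prop. 5.3;
nothing here bears on [IUTchIII] Cor. 3.12; typed ≠ proved.
-/

noncomputable section

namespace Literature.AnabelianGeometry.EtaleTheta

open Literature.AlgebraicGeometry.Frobenioids Function

universe v

namespace RlfIsoWeak

variable {M N L : Type v} [CommMonoid M] [CommMonoid N] [CommMonoid L]
  (hM : IsPerfFactorialCof M) (hN : IsPerfFactorialCof N) (hL : IsPerfFactorialCof L)

/-- **`f^rlf : M^rlf → N^rlf`** over `f^pf`, for any hom between two weakly perf-factorial monoids with cofinal perfection (weak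
universal property). [cite: MochizukiFrdI2008, Prop. 5.3 p.103] -/
def map (f : M →* N) : hM.weak.Rlf →* hN.weak.Rlf :=
  Classical.choose (RlfUniversalWeak.existsUnique_map hM.weak hM.rlfCofinal hN.weak hN.weak.supports_rlf_R f).exists

/-- The defining property: `f^rlf ∘ ι_M = ι_N ∘ f^pf`. [cite: MochizukiFrdI2008, Prop. 5.3 p.103] -/
theorem map_comp_toRealification (f : M →* N) :
    (map hM hN f).comp hM.weak.toRealification =
      hN.weak.toRealification.comp (Literature.AlgebraicGeometry.Frobenioids.Perfection.map f) :=
  Classical.choose_spec (RlfUniversalWeak.existsUnique_map hM.weak hM.rlfCofinal hN.weak hN.weak.supports_rlf_R f).exists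

/-- The defining property on elements. [cite: MochizukiFrdI2008, Prop. 5.3 p.103] -/
theorem map_toRealification (f : M →* N) (a : Perfection M) :
    map hM hN f (hM.weak.toRealification a) = hN.weak.toRealification (Literature.AlgebraicGeometry.Frobenioids.Perfection.map f a) := by
  have h := DFunLike.congr_fun (map_comp_toRealification hM hN f) a
  rwa [MonoidHom.comp_apply, MonoidHom.comp_apply] at h

/-- Functoriality: `(g ∘ f)^rlf = g^rlf ∘ f^rlf`. [cite: MochizukiFrdI2008, Prop. 5.3 p.103] -/
theorem map_comp_map (f : M →* N) (g : N →* L) : map hM hL (g.comp f) = (map hN hL g).comp (map hM hN f) :=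
  RlfUniversalWeak.map_comp hM.weak hM.rlfCofinal hN.weak hL.weak hL.weak.supports_rlf_R f g (map hM hN f)
    (map_comp_toRealification hM hN f) (map hN hL g) (map_comp_toRealification hN hL g) _ (map_comp_toRealification hM hL _)

/-- Functoriality: `id^rlf = id`. [cite: MochizukiFrdI2008, Prop. 5.3 p.103] -/
theorem map_id' : map hM hM (MonoidHom.id M) = MonoidHom.id _ :=
  RlfUniversalWeak.map_id hM.weak hM.rlfCofinal hM.weak.supports_rlf_R _ (map_comp_toRealification hM hM _)

/-- An isomorphism composed with its inverse is the identity hom. [folklore] -/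
private theorem symm_comp_eq_id (e : M ≃* N) : e.symm.toMonoidHom.comp e.toMonoidHom = MonoidHom.id M :=
  MonoidHom.ext fun x => e.symm_apply_apply x

/-- `(e⁻¹)^rlf ∘ e^rlf = id`. [cite: MochizukiFrdI2008, Prop. 5.3 p.103] -/
theorem map_symm_comp_map (e : M ≃* N) : (map hN hM e.symm.toMonoidHom).comp (map hM hN e.toMonoidHom) = MonoidHom.id _ := by
  rw [← map_comp_map hM hN hM, symm_comp_eq_id, map_id']

/-- `e^rlf ∘ (e⁻¹)^rlf = id`. [cite: MochizukiFrdI2008, Prop. 5.3 p.103] -/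
theorem map_comp_map_symm (e : M ≃* N) : (map hM hN e.toMonoidHom).comp (map hN hM e.symm.toMonoidHom) = MonoidHom.id _ := by
  rw [← map_comp_map hN hM hN, show e.toMonoidHom.comp e.symm.toMonoidHom = MonoidHom.id N from
    MonoidHom.ext fun x => e.apply_symm_apply x, map_id']

/-- **`M^rlf ≅ N^rlf` along a monoid isomorphism `e : M ≅ N`** (two weakly perf-factorial monoids with cofinal perfection).
[cite: MochizukiFrdI2008, Prop. 5.3 p.103] -/
def equiv (e : M ≃* N) : hM.weak.Rlf ≃* hN.weak.Rlf :=
  MonoidHom.toMulEquiv (map hM hN e.toMonoidHom) (map hN hM e.symm.toMonoidHom) (map_symm_comp_map hM hN e)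
    (map_comp_map_symm hM hN e)

/-- `equiv e` as a hom is `e^rlf`. [cite: MochizukiFrdI2008, Prop. 5.3 p.103] -/
theorem equiv_apply (e : M ≃* N) (x : hM.weak.Rlf) : equiv hM hN e x = map hM hN e.toMonoidHom x := rfl

/-- Its inverse is `(e⁻¹)^rlf`. [cite: MochizukiFrdI2008, Prop. 5.3 p.103] -/
theorem equiv_symm_apply (e : M ≃* N) (y : hN.weak.Rlf) : (equiv hM hN e).symm y = map hN hM e.symm.toMonoidHom y := rfl

/-- **`equiv e` lies over `e^pf`**: `equiv e (ι a) = ι (e^pf a)`. [cite: MochizukiFrdI2008, Prop. 5.3 p.103] -/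
theorem equiv_toRealification (e : M ≃* N) (a : Perfection M) :
    equiv hM hN e (hM.weak.toRealification a) =
      hN.weak.toRealification (Literature.AlgebraicGeometry.Frobenioids.Perfection.map e.toMonoidHom a) :=
  map_toRealification hM hN e.toMonoidHom a

/-- The inverse lies over `(e⁻¹)^pf`. [cite: MochizukiFrdI2008, Prop. 5.3 p.103] -/
theorem equiv_symm_toRealification (e : M ≃* N) (b : Perfection N) :
    (equiv hM hN e).symm (hN.weak.toRealification b) =
      hM.weak.toRealification (Literature.AlgebraicGeometry.Frobenioids.Perfection.map e.symm.toMonoidHom b) :=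
  map_toRealification hN hM e.symm.toMonoidHom b

/-- `e^pf ∘ (e⁻¹)^pf = id` on elements. [cite: MochizukiFrdI2008, §0 p.11] -/
theorem perfection_map_apply_symm (e : M ≃* N) (b : Perfection N) :
    Literature.AlgebraicGeometry.Frobenioids.Perfection.map e.toMonoidHom
        (Literature.AlgebraicGeometry.Frobenioids.Perfection.map e.symm.toMonoidHom b) = b := by
  obtain ⟨⟨x, n⟩, rfl⟩ := Perfection.mk_surjective b
  show Perfection.mk (e (e.symm x)) n = Perfection.mk x n
  rw [e.apply_symm_apply]

/-- **The isomorphism carries `im(M^pf → M^rlf)` ONTO `im(N^pf → N^rlf)`** (print's `Φ`-images correspond).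
[cite: MochizukiFrdI2008, Def. 2.4(i) p.47] -/
theorem map_mrange_toRealification_eq (e : M ≃* N) :
    (MonoidHom.mrange hM.weak.toRealification).map (equiv hM hN e).toMonoidHom = MonoidHom.mrange hN.weak.toRealification := by
  refine le_antisymm ?_ ?_
  · rintro _ ⟨_, ⟨a, rfl⟩, rfl⟩
    exact ⟨_, (equiv_toRealification hM hN e a).symm⟩
  · rintro _ ⟨b, rfl⟩
    refine ⟨hM.weak.toRealification (Literature.AlgebraicGeometry.Frobenioids.Perfection.map e.symm.toMonoidHom b), ⟨_, rfl⟩, ?_⟩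
    show equiv hM hN e _ = _
    rw [equiv_toRealification, perfection_map_apply_symm]

/-- Membership form: `x ∈ im(M^pf)` iff `equiv e x ∈ im(N^pf)`. [cite: MochizukiFrdI2008, Def. 2.4(i) p.47] -/
theorem mem_mrange_iff (e : M ≃* N) (x : hM.weak.Rlf) :
    equiv hM hN e x ∈ MonoidHom.mrange hN.weak.toRealification ↔ x ∈ MonoidHom.mrange hM.weak.toRealification := by
  constructor
  · rintro ⟨b, hb⟩
    refine ⟨Literature.AlgebraicGeometry.Frobenioids.Perfection.map e.symm.toMonoidHom b, ?_⟩
    apply (equiv hM hN e).injective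
    rw [equiv_toRealification, perfection_map_apply_symm, hb]
  · rintro ⟨a, rfl⟩
    exact ⟨_, (equiv_toRealification hM hN e a).symm⟩

/-- **`equiv e` is `ℝ`-linear on `(M^rlf)^gp`** (every hom between weak realifications is — abc-iut-L1-d2's `map_realSMul`).
[cite: MochizukiFrdI2008, Def. 2.4(i) p.48] -/
theorem equiv_realSMul (e : M ≃* N) (r : ℝ) (ξ : Algebra.GrothendieckGroup hM.weak.Rlf) :
    MonGp.map (equiv hM hN e).toMonoidHom (IsPerfFactorialWeak.Rlf.realSMul hM.weak r ξ) =
      IsPerfFactorialWeak.Rlf.realSMul hN.weak r (MonGp.map (equiv hM hN e).toMonoidHom ξ) :=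
  IsPerfFactorialWeak.Rlf.map_realSMul hM.weak hN.weak _ r ξ

end RlfIsoWeak

end Literature.AnabelianGeometry.EtaleTheta

end
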